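import Mathlib
import HarnessLib
import Literature.MathematicalPhysics.QuantumLattice.KohnLuttingerFermiCurvePolar
import Literature.MathematicalPhysics.QuantumLattice.HubbardBandSectorCountingBounds
import Literature.MathematicalPhysics.QuantumLattice.FermiRG.FST2Regularity
import Summits.HubbardSuperconductivity.HubbardSuperconductivity.Theorems.KLProgrammeFermiSurfaceFST2
import Summits.HubbardSuperconductivity.HubbardSuperconductivity.Theorems.KLProgrammeFermiSurfaceSharpEnvelope

/-!
# Route `KLProgramme` (cruxes K3/K1, risk r2) — FST II Theorem 1.1 (two-loop volume) for the Hubbard band, part 4: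
# FST's two-loop volume `𝓦(ε)` of the band in POLAR coordinates (arc length ↦ polar angle)

Cell `gate-hubbard-kl`, seat fs-1 (g5), risk-register item r2. `FermiRG.volW (Crystal.cubic 2) (ε - μ) ε'` (typed FST II
object (cWdef), `FST2Regularity.lean`) is the supremum over `q` and signs `v₁, v₂ = ±1` of the `μH¹⌊(S∩F) ⊗ μH¹⌊(S∩F)`-measure of
`{(p₁, p₂) : |ε(v₁p₁ + v₂p₂ + q) - μ| ≤ ε'}`. For the Hubbard band on `-4 < μ < 0`, `S ∩ F` is the range of the polar chart
`θ ↦ p_μ(θ)` on `(-π, π]` and arc length is `‖p_μ'‖ dθ` (`map_fermiPolar_withDensity_speed`, the tree's area formula), with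
`‖p_μ'‖² = u'² + u² ≤ 2u² < 2π²` (`klfs_radiusDeriv_sq_le`, `klfs_bandFermiRadius_lt_pi`). Hence (`kltl_volW_le_of_angular`):
if for every sign `τ = ±1` and shift `q' ∈ ℝ²` the iterated angular integral
`∫_{[-π,π]} dθ₁ vol{θ₂ ∈ [-π, π] : |ε₂(X(θ₂) - (τX(θ₁) + q'₁), Y(θ₂) - (τY(θ₁) + q'₂)) - μ| ≤ ε'}` is `≤ M`, then
`𝓦(ε') ≤ 2π² · M` — the four sign choices reduce to `τ = ∓v₁`, `q' = ∓q` by the evenness of `ε₂`. This is the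
measure-theoretic bridge between the typed FST object and p1b's angular shell-measure vocabulary (`eps2`, `bandX/Y`).
No definitions; everything PROVED. [folklore]
-/

noncomputable section

open Real Set MeasureTheory
open scoped ENNReal

-- the tree's namespace `Summit.<Summit>.<Problem>.Theorems` repeats the summit name by design (D-0017)
set_option linter.dupNamespace false

namespace Summit.HubbardSuperconductivity.HubbardSuperconductivity.Theorems

open Literature.MathematicalPhysics.QuantumLattice
open Literature.MathematicalPhysics.QuantumLattice.BandSectorCounting

section Polar

variable {μ : ℝ} (hμ₁ : -4 < μ) (hμ₂ : μ < 0)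
include hμ₁ hμ₂

omit hμ₁ hμ₂ in
/-- FST's representatives `S ∩ F` of the Hubbard band's Fermi surface are RKS's Fermi curve `{k ∈ [-π,π)² : ε k = μ}`. [folklore] -/
theorem kltl_fermiSurfaceRep_eq_fermiCurve :
    (FermiRG.Crystal.cubic 2).fermiSurfaceRep (fun q : Momentum => squareDispersion 1 0 q - μ) =
      fermiCurve (squareDispersion 1 0) μ := by
  ext p
  rw [FermiRG.Crystal.mem_fermiSurfaceRep, klfs_mem_cubic_fundamentalDomain, sub_eq_zero]
  simp only [fermiCurve, brillouinZone, mem_setOf_eq, mem_Ico]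
  tauto

omit hμ₁ hμ₂ in
/-- In the plane the surface dimension of FST's `𝓦` is `1`. [folklore] -/
theorem kltl_surfaceDim_two : FermiRG.surfaceDim Momentum = 1 := by
  simp [FermiRG.surfaceDim, finrank_euclideanSpace]

/-- The speed of the polar chart is at most `√2 π`. [folklore] -/
theorem kltl_norm_fermiPolarVelocity_le (θ : ℝ) : ‖fermiPolarVelocity μ θ‖ ≤ Real.sqrt 2 * π := by
  have hsq := norm_fermiPolarVelocity_sq μ θ
  have h1 := klfs_radiusDeriv_sq_le hμ₁ hμ₂ θ
  have h2 := klfs_bandFermiRadius_lt_pi hμ₁ hμ₂ θ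
  have hu := bandFermiRadius_pos hμ₁ hμ₂ θ
  have h0 : 0 ≤ ‖fermiPolarVelocity μ θ‖ := norm_nonneg _
  have hs2 : Real.sqrt 2 ^ 2 = 2 := Real.sq_sqrt (by norm_num)
  have hR : 0 ≤ Real.sqrt 2 * π := by positivity
  have hle : ‖fermiPolarVelocity μ θ‖ ^ 2 ≤ (Real.sqrt 2 * π) ^ 2 := by
    rw [mul_pow, hs2]; nlinarith
  calc ‖fermiPolarVelocity μ θ‖ = Real.sqrt (‖fermiPolarVelocity μ θ‖ ^ 2) := (Real.sqrt_sq h0).symm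
    _ ≤ Real.sqrt ((Real.sqrt 2 * π) ^ 2) := Real.sqrt_le_sqrt hle
    _ = Real.sqrt 2 * π := Real.sqrt_sq hR

/-- Arc length on `S ∩ F` is dominated by `√2π` times the push-forward of `dθ⌊(-π, π]` under the polar chart. [folklore] -/
theorem kltl_hausdorff_restrict_le :
    (μH[1] : Measure Momentum).restrict (fermiCurve (squareDispersion 1 0) μ) ≤
      ENNReal.ofReal (Real.sqrt 2 * π) • Measure.map (fermiPolar μ) (volume.restrict (Ioc (-π) π)) := by
  rw [← map_fermiPolar_withDensity_speed hμ₁ hμ₂, ← Measure.map_smul, ← withDensity_const]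
  refine Measure.map_mono (withDensity_mono (Filter.Eventually.of_forall fun θ => ?_))
    (continuous_fermiPolar hμ₁ hμ₂).measurable
  exact ENNReal.ofReal_le_ofReal (kltl_norm_fermiPolarVelocity_le hμ₁ hμ₂ θ)

omit hμ₁ hμ₂ in
/-- The two-loop constraint in coordinates: `|ε(v₁ p_μ(θ₁) + v₂ p_μ(θ₂) + q) - μ| ≤ ε'` is
`|ε₂(X(θ₂) - (τX(θ₁) + q'₁), Y(θ₂) - (τY(θ₁) + q'₂)) - μ| ≤ ε'` with `τ = -v₁v₂`, `q' = -v₂ q` (`v₂ = ±1`). [folklore] -/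
theorem kltl_twoLoop_constraint_iff (v₁ : ℝ) {v₂ : ℝ} (hv₂ : v₂ = 1 ∨ v₂ = -1)
    (q : Momentum) (θ₁ θ₂ ε' : ℝ) :
    |squareDispersion 1 0 (v₁ • fermiPolar μ θ₁ + v₂ • fermiPolar μ θ₂ + q) - μ| ≤ ε' ↔
      |eps2 (bandX μ θ₂ - (-(v₁ * v₂) * bandX μ θ₁ + -(v₂ * q 0)))
          (bandY μ θ₂ - (-(v₁ * v₂) * bandY μ θ₁ + -(v₂ * q 1))) - μ| ≤ ε' := by
  have hε : squareDispersion 1 0 (v₁ • fermiPolar μ θ₁ + v₂ • fermiPolar μ θ₂ + q) =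
      eps2 (v₁ * bandX μ θ₁ + v₂ * bandX μ θ₂ + q 0) (v₁ * bandY μ θ₁ + v₂ * bandY μ θ₂ + q 1) := by
    rw [squareDispersion_one_zero_eq_sqDispersion, sqDispersion_eq_eps2]
    simp [bandX, bandY]
  rw [hε]
  rcases hv₂ with rfl | rfl
  · have e1 : v₁ * bandX μ θ₁ + 1 * bandX μ θ₂ + q 0 = bandX μ θ₂ - (-(v₁ * 1) * bandX μ θ₁ + -(1 * q 0)) := by ring
    have e2 : v₁ * bandY μ θ₁ + 1 * bandY μ θ₂ + q 1 = bandY μ θ₂ - (-(v₁ * 1) * bandY μ θ₁ + -(1 * q 1)) := by ring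
    rw [e1, e2]
  · have e1 : v₁ * bandX μ θ₁ + -1 * bandX μ θ₂ + q 0 = -(bandX μ θ₂ - (-(v₁ * -1) * bandX μ θ₁ + -(-1 * q 0))) := by ring
    have e2 : v₁ * bandY μ θ₁ + -1 * bandY μ θ₂ + q 1 = -(bandY μ θ₂ - (-(v₁ * -1) * bandY μ θ₁ + -(-1 * q 1))) := by ring
    rw [e1, e2, eps2_neg]

/-- **FST's two-loop volume of the Hubbard band in polar coordinates.** If every iterated angular integral
`∫_{[-π,π]} dθ₁ vol{θ₂ ∈ [-π,π] : |ε₂(p_μ(θ₂) - (τ p_μ(θ₁) + q')) - μ| ≤ ε'}` (`τ = ±1`, `q' ∈ ℝ²`) is `≤ M`, then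
`𝓦(ε') ≤ 2π² M`. [folklore] -/
theorem kltl_volW_le_of_angular (ε' : ℝ) (M : ℝ≥0∞)
    (hM : ∀ τ : ℝ, (τ = 1 ∨ τ = -1) → ∀ q₁ q₂ : ℝ,
      ∫⁻ θ₁ in Icc (-π) π, volume {θ₂ ∈ Icc (-π) π |
          |eps2 (bandX μ θ₂ - (τ * bandX μ θ₁ + q₁)) (bandY μ θ₂ - (τ * bandY μ θ₁ + q₂)) - μ| ≤ ε'} ≤ M) :
    FermiRG.volW (FermiRG.Crystal.cubic 2) (fun q : Momentum => squareDispersion 1 0 q - μ) ε' ≤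
      ENNReal.ofReal (2 * π ^ 2) * M := by
  have hπ := Real.pi_pos
  unfold FermiRG.volW
  rw [kltl_surfaceDim_two, kltl_fermiSurfaceRep_eq_fermiCurve]
  refine iSup_le fun q => iSup_le fun v₁ => iSup_le fun hv₁ => iSup_le fun v₂ => iSup_le fun hv₂ => ?_
  -- notation
  set ν : Measure Momentum := (μH[1] : Measure Momentum).restrict (fermiCurve (squareDispersion 1 0) μ) with hν
  set m : Measure Momentum := Measure.map (fermiPolar μ) (volume.restrict (Ioc (-π) π)) with hm
  set c : ℝ≥0∞ := ENNReal.ofReal (Real.sqrt 2 * π) with hc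
  set T : Set (Momentum × Momentum) :=
    {x | |(fun q : Momentum => squareDispersion 1 0 q - μ) (v₁ • x.1 + v₂ • x.2 + q)| ≤ ε'} with hT
  have hγ : Measurable (fermiPolar μ) := (continuous_fermiPolar hμ₁ hμ₂).measurable
  have hTm : MeasurableSet T := by
    have hcont : Continuous fun x : Momentum × Momentum =>
        |(fun q : Momentum => squareDispersion 1 0 q - μ) (v₁ • x.1 + v₂ • x.2 + q)| := by
      have hε : Continuous (squareDispersion 1 0) := by
        unfold squareDispersion; fun_prop
      exact ((hε.comp (by fun_prop)).sub continuous_const).abs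
    exact measurableSet_le hcont.measurable measurable_const
  have hνle : ν ≤ c • m := kltl_hausdorff_restrict_le hμ₁ hμ₂
  -- domination of the product measure
  have h1 : (ν.prod ν) T ≤ ((c • m).prod (c • m)) T := Measure.prod_mono hνle hνle T
  have h2 : ((c • m).prod (c • m)) T = c * (c * (m.prod m) T) := by
    rw [Measure.prod_smul_left, Measure.prod_smul_right, Measure.smul_apply, Measure.smul_apply, smul_eq_mul, smul_eq_mul]
  -- the product of the push-forwards as an iterated angular integral
  have h3 : (m.prod m) T ≤ ∫⁻ θ₁ in Icc (-π) π, volume {θ₂ ∈ Icc (-π) π |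
      |eps2 (bandX μ θ₂ - (-(v₁ * v₂) * bandX μ θ₁ + -(v₂ * q 0)))
        (bandY μ θ₂ - (-(v₁ * v₂) * bandY μ θ₁ + -(v₂ * q 1))) - μ| ≤ ε'} := by
    rw [Measure.prod_apply hTm, hm]
    refine (lintegral_map_le _ _).trans ?_
    refine (lintegral_mono' (Measure.restrict_mono Ioc_subset_Icc_self le_rfl) (le_refl _)).trans ?_
    refine lintegral_mono fun θ₁ => ?_
    rw [Measure.map_apply hγ (measurable_prodMk_left hTm), Measure.restrict_apply (hγ (measurable_prodMk_left hTm))]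
    refine (measure_mono ?_)
    intro θ₂ hθ₂
    refine ⟨Ioc_subset_Icc_self hθ₂.2, ?_⟩
    have h := hθ₂.1
    simp only [mem_preimage, hT, mem_setOf_eq] at h
    exact (kltl_twoLoop_constraint_iff v₁ hv₂ q θ₁ θ₂ ε').1 h
  have hτ : -(v₁ * v₂) = 1 ∨ -(v₁ * v₂) = -1 := by
    rcases hv₁ with rfl | rfl <;> rcases hv₂ with rfl | rfl <;> norm_num
  have h4 := hM (-(v₁ * v₂)) hτ (-(v₂ * q 0)) (-(v₂ * q 1))
  have hcc : c * c = ENNReal.ofReal (2 * π ^ 2) := by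
    rw [hc, ← ENNReal.ofReal_mul (by positivity)]
    congr 1
    have : Real.sqrt 2 * Real.sqrt 2 = 2 := Real.mul_self_sqrt (by norm_num)
    nlinarith
  calc (ν.prod ν) T ≤ ((c • m).prod (c • m)) T := h1
    _ = c * (c * (m.prod m) T) := h2
    _ ≤ c * (c * M) := by gcongr; exact h3.trans h4
    _ = ENNReal.ofReal (2 * π ^ 2) * M := by rw [← mul_assoc, hcc]

end Polar

end Summit.HubbardSuperconductivity.HubbardSuperconductivity.Theorems

end
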